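import Literature.MathematicalPhysics.QuantumFieldTheory.QCDGammaFiveConjugation
import Literature.MathematicalPhysics.QuantumFieldTheory.QCDFlavourSymmetry
import Summits.QuantumFields.QCD.Theorems.QuarksNoInfraredClauseTorusHalfSpectrumStubOsAdjointCharge
import Summits.QuantumFields.QCD.Theorems.QuarksNoInfraredClauseTorusHalfSpectrumStubGammaFiveConjExists
import HarnessLib

/-!
# Crux `TorusHalfSpectrum` (stmt-QuantumFields-9508), line `registered` (`Lines/birth.lean`, reshape v6) —
# stub `stub_gammaFiveConj_observable` (K2): the observable-level `γ₅`-conjugation `A ↦ A^K`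

Stub K2 of the birth skeleton of the crux
`Summit.QuantumFields.QCD.Theses.QuarksNoInfraredClause.TorusHalfSpectrum` (= `ConjugationObservableStmt`
unfolded): there is an operation `Kobs` on gauge-invariant local lattice-QCD observables such that

1. (charge flip) if `A` is homogeneous of charge `q ∈ ℤ^{N_f}` under the vector flavour torus
   (`flavourScale t (A.F U) = (∏_f t_f^{q_f}) • A.F U`, `t ∈ (ℂˣ)^{N_f}`), then `Kobs A` is homogeneous of
   charge `−q`;
2. (`ΘK = KΘ`, pointwise) `(Kobs A)^Θ (U) = Kobs (A^Θ) (U)` for the Osterwalder–Seiler adjoint `A^Θ = A.osAdjoint`;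
3. the same after placing the observables on any torus (`onTorus`);
4. (placement) for EVERY `γ₅`-conjugation `K` of the torus quark Grassmann algebra (a multiplicative,
   additive, antilinear, unital map with `K ψ_{f,x,a,α} = −∑_σ (γ₅)_{σα} ψ̄_{f,x,a,σ}`,
   `K ψ̄_{f,x,a,α} = ∑_σ (γ₅)_{ασ} ψ_{f,x,a,σ}`), `(Kobs A).onTorus S v U = K (A.onTorus S v U)`.

The witness is the Literature conjugate observable `QCDLatticeObservable.kConj` (`(A^K)(U) = K(A(U))` with the
boxed `γ₅`-conjugation `fermiK = Λ(K₀) ∘ conj`, `K₀ = fermiKLin`, of `QCDGammaFiveConjugation.lean`).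

Proofs.

* Charge flip (pattern of the sibling stub file `…StubOsAdjointCharge`): on generator coefficients the
  diagonal flavour weight map `D_s` satisfies `D_s ∘ K₀ = K₀ ∘ conj(D_{(s̄)⁻¹})` (`K₀` moves a `ψ_f`-coefficient
  to a `ψ̄_f`-slot of the SAME flavour), hence `flavourScale s (K y) = K (flavourScale (s̄)⁻¹ y)` on the boxed
  Grassmann algebra, and antilinearity of `K` conjugates the character: `conj ∏ ((s̄)⁻¹_f)^{q_f} = ∏ s_f^{−q_f}`.
* `ΘK = KΘ` on the boxed Grassmann algebra (`fermiTheta_fermiK`): by `ExteriorAlgebra.induction`; on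
  generators it is the coefficient identity `T (conj (K₀ (conj c))) = K₀ (conj (T (conj c)))`
  (`T = fermiThetaLin`), i.e. entrywise `γ₀ γ̄₅ = −γ₅ γ̄₀`, which holds because `γ₅ γ₀ = −γ₀ γ₅`, `γ₀` is
  hermitian and `γ₅ = diag(1,1,−1,−1)` is real (`fin_cases`); products use that `Θ` reverses and `K`
  preserves the order.  Conjuncts 2 and 3 follow by unfolding `osAdjoint`, `kConj`, `onTorus`.
* Placement (pattern of `placeLin_comp_fermiThetaLin` / `map_placeLin_fermiTheta` / `osAdjoint_onTorus` of
  `QCDTimeReflectionProofs.lean`, without site reflection): `P_v ∘ K₀ = K₀^{torus} ∘ P_v` on coefficients,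
  hence `Λ(P_v) (K a) = torusK (Λ(P_v) a)` and `(A^K).onTorus S v U = torusK (A.onTorus S v U)`; finally every
  `γ₅`-conjugation `K` IS `torusK` (`eq_torusK_of_clauses` of the sibling stub file `…StubGammaFiveConjExists`).

Everything used is proved in the tree (no named fact).  Sources: I. Montvay, G. Münster, *Quantum Fields on
a Lattice* (CUP 1994) §4.2 (4.35) (`γ₅`-hermiticity), §4.2.3 (4.91), (4.99) (the reflection `Θ`), §5.1.1 (5.6)
(flavour symmetry); K. Osterwalder, E. Seiler, Ann. Phys. 110 (1978) 440, §2.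
-/

noncomputable section

namespace Summit.QuantumFields.QCD.Cruxes.TorusHalfSpectrum.Birth.GammaFiveConjObservable

open scoped BigOperators ComplexConjugate
open Literature.Probability.LatticeModels Literature.MathematicalPhysics.QuantumFieldTheory
  Literature.MathematicalPhysics.QuantumLattice
open Summit.QuantumFields.QCD.Cruxes.TorusHalfSpectrum.Birth.OsAdjointCharge
open Summit.QuantumFields.QCD.Cruxes.TorusHalfSpectrum.Birth.GammaFiveConjExists

variable {Nf R : ℕ}

/-! ### Charge flip: the flavour torus against `K` -/

/-- **The diagonal flavour weights against the `γ₅` substitution, on generator coefficients**: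
`D_s ∘ K₀ = K₀ ∘ conj(D_{(s̄)⁻¹})`.  `K₀ = fermiKLin` fills the `ψ̄_{f,x,a,σ}`-slot with a spin combination of
the `ψ_{f,x,a,·}`-coefficients (same flavour `f`), on which the weight of `D_s` is `s_f⁻¹ = conj (((s̄)⁻¹)_f)`;
symmetrically for the `ψ`-slots (`s_f = conj ((((s̄)⁻¹)_f)⁻¹)`). -/
theorem flavourLin_comp_fermiKLin (s : Fin Nf → ℂ) :
    (LinearMap.pi fun w => QCDLatticeObservable.flavourWeight s w •
        (LinearMap.proj w : (BoxFermiIdx Nf R ⊕ₗ BoxFermiIdx Nf R → ℂ) →ₗ[ℂ] ℂ)) ∘ₗ fermiKLin =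
      fermiKLin ∘ₗ conjLin (LinearMap.pi fun w => QCDLatticeObservable.flavourWeight (star s)⁻¹ w •
        (LinearMap.proj w : (BoxFermiIdx Nf R ⊕ₗ BoxFermiIdx Nf R → ℂ) →ₗ[ℂ] ℂ)) := by
  refine LinearMap.ext fun c => funext fun w => ?_
  obtain ⟨x, rfl⟩ : ∃ x, toLex x = w := ⟨ofLex w, rfl⟩
  rcases x with i | i
  · simp only [LinearMap.comp_apply, fermiKLin, conjLin_apply, LinearMap.pi_apply, ofLex_toLex,
      LinearMap.coe_sum, Finset.sum_apply, LinearMap.smul_apply, LinearMap.proj_apply,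
      Equiv.symm_apply_apply, Pi.star_apply, Pi.inv_apply, star_mul', star_star, star_inv₀,
      smul_eq_mul, Finset.mul_sum, QCDLatticeObservable.flavourWeight_inl,
      QCDLatticeObservable.flavourWeight_inr]
    refine Finset.sum_congr rfl fun α _ => ?_
    ring
  · simp only [LinearMap.comp_apply, fermiKLin, conjLin_apply, LinearMap.pi_apply, ofLex_toLex,
      LinearMap.coe_sum, Finset.sum_apply, LinearMap.smul_apply, LinearMap.proj_apply,
      Equiv.symm_apply_apply, Pi.star_apply, Pi.inv_apply, star_mul', star_star, inv_inv,
      smul_eq_mul, Finset.mul_sum, QCDLatticeObservable.flavourWeight_inl,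
      QCDLatticeObservable.flavourWeight_inr]
    refine Finset.sum_congr rfl fun α _ => ?_
    ring

/-- **The vector flavour torus against `K` on the boxed quark Grassmann algebra**:
`s · K(y) = K ((s̄)⁻¹ · y)` — conjugate-inverse weights because `K` is antilinear and exchanges `ψ_f`
with `ψ̄_f` (weights `t_f` and `t_f⁻¹`); no reversal is involved. -/
theorem flavourScale_fermiK (s : Fin Nf → ℂ) (y : BoxFermiAlg Nf R) :
    QCDLatticeObservable.flavourScale s (fermiK y) =
      fermiK (QCDLatticeObservable.flavourScale (star s)⁻¹ y) := by
  simp only [fermiK_apply, QCDLatticeObservable.flavourScale_eq]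
  rw [← AlgHom.comp_apply, ExteriorAlgebra.map_comp_map, grassmannConj_map,
    ← AlgHom.comp_apply (ExteriorAlgebra.map fermiKLin), ExteriorAlgebra.map_comp_map,
    flavourLin_comp_fermiKLin]

/-- **Conjunct 1 (charge flip)**: the `γ₅`-conjugate of a flavour-homogeneous observable of charge `q` is
flavour-homogeneous of charge `−q`:
`flavourScale s ((A^K)(U)) = K (flavourScale (s̄)⁻¹ (A(U))) = conj (∏ ((s̄)⁻¹_f)^{q_f}) • (A^K)(U)
= (∏ s_f^{−q_f}) • (A^K)(U)`. -/
theorem kConj_charge :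
    ∀ (Nf R : ℕ) (A : QCDLatticeObservable Nf R) (qA : Fin Nf → ℤ),
      (∀ t : Fin Nf → ℂ, (∀ f, t f ≠ 0) → ∀ U,
          QCDLatticeObservable.flavourScale t (A.F U) = (∏ f, t f ^ (qA f)) • A.F U) →
      ∀ t : Fin Nf → ℂ, (∀ f, t f ≠ 0) → ∀ U,
          QCDLatticeObservable.flavourScale t (A.kConj.F U) =
            (∏ f, t f ^ ((-qA) f)) • A.kConj.F U := by
  intro Nf R A qA hA s hs U
  have hs' : ∀ f, (star s)⁻¹ f ≠ 0 := fun f => by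
    rw [Pi.inv_apply, Pi.star_apply]
    exact inv_ne_zero (star_ne_zero.2 (hs f))
  rw [QCDLatticeObservable.kConj_F, flavourScale_fermiK, hA _ hs' _, LinearMap.map_smulₛₗ,
    conj_prod_star_inv_zpow]

/-! ### `Θ K = K Θ` -/

/-- `γ₀ γ̄₅ = −γ₅ γ̄₀` entrywise, first index pattern:
`∑_α (γ₀)_{σα} conj (γ₅)_{βα} = ∑_α (−γ₅)_{σα} conj (γ₀)_{βα}` (`γ₅γ₀ = −γ₀γ₅`, `γ₀ᴴ = γ₀`, `γ₅` real). -/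
theorem sum_gammaZero_mul_star_gammaFive (σ β : Fin 4) :
    ∑ α, euclideanGamma 0 σ α * star (gammaFive β α) =
      ∑ α, -gammaFive σ α * star (euclideanGamma 0 β α) := by
  fin_cases σ <;> fin_cases β <;> simp [euclideanGamma_zero, gammaFive_eq_diagonal, Fin.sum_univ_four]

/-- `γ₀ᵀ (−γ̄₅) = γ₅ᵀ γ̄₀` entrywise, second index pattern:
`∑_α (γ₀)_{ασ} conj (−γ₅)_{αβ} = ∑_α (γ₅)_{ασ} conj (γ₀)_{αβ}`. -/
theorem sum_gammaZero_mul_star_neg_gammaFive (σ β : Fin 4) :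
    ∑ α, euclideanGamma 0 α σ * star (-gammaFive α β) =
      ∑ α, gammaFive α σ * star (euclideanGamma 0 α β) := by
  fin_cases σ <;> fin_cases β <;> simp [euclideanGamma_zero, gammaFive_eq_diagonal, Fin.sum_univ_four]

/-- The `ψ̄`-coordinates of `T c` (box): `(T c)_{ψ̄,(f,y,a,β)} = ∑_α (γ₀)_{βα} c_{ψ,(f,θy,a,α)}`. -/
theorem fermiThetaLin_apply_inl (c : (BoxFermiIdx Nf R ⊕ₗ BoxFermiIdx Nf R) → ℂ) (v : BoxQuarkVar Nf R) :
    fermiThetaLin c (toLex (Sum.inl (boxQuarkEquiv v))) =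
      ∑ α : Fin 4, euclideanGamma 0 v.2.2.2 α *
        c (toLex (Sum.inr (boxQuarkEquiv (v.1, (boxSiteReflect v.2.1, v.2.2.1, α))))) := by
  simp only [fermiThetaLin, LinearMap.pi_apply, ofLex_toLex, Equiv.symm_apply_apply,
    LinearMap.coe_sum, Finset.sum_apply, LinearMap.smul_apply, LinearMap.proj_apply, smul_eq_mul]

/-- The `ψ`-coordinates of `T c` (box): `(T c)_{ψ,(f,y,a,β)} = ∑_α (γ₀)_{αβ} c_{ψ̄,(f,θy,a,α)}`. -/
theorem fermiThetaLin_apply_inr (c : (BoxFermiIdx Nf R ⊕ₗ BoxFermiIdx Nf R) → ℂ) (v : BoxQuarkVar Nf R) :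
    fermiThetaLin c (toLex (Sum.inr (boxQuarkEquiv v))) =
      ∑ α : Fin 4, euclideanGamma 0 α v.2.2.2 *
        c (toLex (Sum.inl (boxQuarkEquiv (v.1, (boxSiteReflect v.2.1, v.2.2.1, α))))) := by
  simp only [fermiThetaLin, LinearMap.pi_apply, ofLex_toLex, Equiv.symm_apply_apply,
    LinearMap.coe_sum, Finset.sum_apply, LinearMap.smul_apply, LinearMap.proj_apply, smul_eq_mul]

/-- **The reflection and the `γ₅` substitutions commute up to conjugation, on generator coefficients**:
`T (conj (K₀ (conj c))) = K₀ (conj (T (conj c)))` — the coefficient form of `ΘK = KΘ` on degree one. -/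
theorem fermiThetaLin_star_fermiKLin_star (c : (BoxFermiIdx Nf R ⊕ₗ BoxFermiIdx Nf R) → ℂ) :
    fermiThetaLin (star (fermiKLin (Nf := Nf) (R := R) (star c))) =
      fermiKLin (star (fermiThetaLin (star c))) := by
  funext w
  obtain ⟨x, rfl⟩ : ∃ x, toLex x = w := ⟨ofLex w, rfl⟩
  rcases x with i | i
  · obtain ⟨v, rfl⟩ := boxQuarkEquiv.surjective i
    rw [fermiThetaLin_apply_inl, fermiKLin_apply_inl]
    simp only [Pi.star_apply, fermiKLin_apply_inr, fermiThetaLin_apply_inr, star_sum, star_mul',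
      star_star, Finset.mul_sum]
    rw [Finset.sum_comm]
    conv_rhs => rw [Finset.sum_comm]
    simp_rw [← mul_assoc, ← Finset.sum_mul, sum_gammaZero_mul_star_gammaFive]
  · obtain ⟨v, rfl⟩ := boxQuarkEquiv.surjective i
    rw [fermiThetaLin_apply_inr, fermiKLin_apply_inr]
    simp only [Pi.star_apply, fermiKLin_apply_inl, fermiThetaLin_apply_inl, star_sum, star_mul',
      star_star, Finset.mul_sum]
    rw [Finset.sum_comm]
    conv_rhs => rw [Finset.sum_comm]
    simp_rw [← mul_assoc, ← Finset.sum_mul, sum_gammaZero_mul_star_neg_gammaFive]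

/-- **`Θ K = K Θ` on the boxed quark Grassmann algebra**: the Osterwalder–Seiler reflection
`Θ = rev ∘ Λ(T) ∘ conj` and the `γ₅`-conjugation `K = Λ(K₀) ∘ conj` commute (generators:
`fermiThetaLin_star_fermiKLin_star`; products: `Θ` reverses, `K` preserves the order). -/
theorem fermiTheta_fermiK (a : BoxFermiAlg Nf R) : fermiTheta (fermiK a) = fermiK (fermiTheta a) := by
  induction a using ExteriorAlgebra.induction with
  | algebraMap c => simp only [fermiK_algebraMap, fermiTheta_algebraMap]
  | ι u =>
    simp only [fermiK_ι, fermiTheta_ι]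
    rw [fermiThetaLin_star_fermiKLin_star]
  | mul a b ha hb => simp only [fermiK_mul, fermiTheta_mul, ha, hb]
  | add a b ha hb => simp only [map_add, ha, hb]

/-- **Conjunct 2**: `(A^K)^Θ (U) = (A^Θ)^K (U)` — both are `Θ K (A(θU)) = K Θ (A(θU))`. -/
theorem kConj_osAdjoint_F (A : QCDLatticeObservable Nf R)
    (U : LGConfig 4 (Matrix.specialUnitaryGroup (Fin 3) ℂ)) :
    A.kConj.osAdjoint.F U = A.osAdjoint.kConj.F U := by
  simp only [QCDLatticeObservable.osAdjoint_F, QCDLatticeObservable.kConj_F, fermiTheta_fermiK]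

/-- **Conjunct 3**: `(A^K)^Θ` and `(A^Θ)^K` agree after placing on any torus (`onTorus` only reads `.F`). -/
theorem kConj_osAdjoint_onTorus (A : QCDLatticeObservable Nf R) (S : ℕ) [NeZero S] (v : Site 4)
    (U : GaugeConfig 4 S (Matrix.specialUnitaryGroup (Fin 3) ℂ)) :
    A.kConj.osAdjoint.onTorus S v U = A.osAdjoint.kConj.onTorus S v U := by
  unfold QCDLatticeObservable.onTorus
  rw [kConj_osAdjoint_F]

/-! ### Placement: `(A^K).onTorus = torusK ∘ A.onTorus` -/

/-- The substitution `K₀` (box) on the coefficient vector of `ψ_{f,x,a,α}`: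
`e_{ψ,(f,x,a,α)} ↦ ∑_β (−γ₅)_{βα} e_{ψ̄,(f,x,a,β)}`. -/
theorem fermiKLin_single_inr (f : Fin Nf) (x : ↥(box 4 R)) (a : Fin 3) (α : Fin 4) :
    fermiKLin (Pi.single (toLex (Sum.inr (boxQuarkEquiv (f, (x, a, α))))) (1 : ℂ)) =
      ∑ β : Fin 4, (-gammaFive β α) •
        Pi.single (toLex (Sum.inl (boxQuarkEquiv (Nf := Nf) (R := R) (f, (x, a, β))))) (1 : ℂ) := by
  funext w
  obtain ⟨y, rfl⟩ : ∃ y, toLex y = w := ⟨ofLex w, rfl⟩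
  rcases y with i | i
  · obtain ⟨⟨f', x', a', β'⟩, rfl⟩ := boxQuarkEquiv.surjective i
    rw [fermiKLin_apply_inl]
    simp only [Finset.sum_apply, Pi.smul_apply, Pi.single_apply, Sum.inr.injEq,
      Sum.inl.injEq, EmbeddingLike.apply_eq_iff_eq, Prod.mk.injEq, smul_eq_mul, mul_ite, mul_one,
      mul_zero]
    by_cases hf : f' = f
    · by_cases ha : a' = a
      · by_cases hx : x' = x
        · subst hf ha hx
          simp [Finset.sum_ite_eq']
        · simp [hx]
      · simp [ha]
    · simp [hf]
  · obtain ⟨v, rfl⟩ := boxQuarkEquiv.surjective i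
    rw [fermiKLin_apply_inr]
    simp only [Finset.sum_apply, Pi.smul_apply, Pi.single_apply, toLex_inj, reduceCtorEq, if_false,
      mul_zero, Finset.sum_const_zero, smul_eq_mul]

/-- The substitution `K₀` (box) on the coefficient vector of `ψ̄_{f,x,a,α}`:
`e_{ψ̄,(f,x,a,α)} ↦ ∑_β (γ₅)_{αβ} e_{ψ,(f,x,a,β)}`. -/
theorem fermiKLin_single_inl (f : Fin Nf) (x : ↥(box 4 R)) (a : Fin 3) (α : Fin 4) :
    fermiKLin (Pi.single (toLex (Sum.inl (boxQuarkEquiv (f, (x, a, α))))) (1 : ℂ)) =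
      ∑ β : Fin 4, (gammaFive α β) •
        Pi.single (toLex (Sum.inr (boxQuarkEquiv (Nf := Nf) (R := R) (f, (x, a, β))))) (1 : ℂ) := by
  funext w
  obtain ⟨y, rfl⟩ : ∃ y, toLex y = w := ⟨ofLex w, rfl⟩
  rcases y with i | i
  · obtain ⟨v, rfl⟩ := boxQuarkEquiv.surjective i
    rw [fermiKLin_apply_inl]
    simp only [Finset.sum_apply, Pi.smul_apply, Pi.single_apply, toLex_inj, reduceCtorEq, if_false,
      mul_zero, Finset.sum_const_zero, smul_eq_mul]
  · obtain ⟨⟨f', x', a', β'⟩, rfl⟩ := boxQuarkEquiv.surjective i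
    rw [fermiKLin_apply_inr]
    simp only [Finset.sum_apply, Pi.smul_apply, Pi.single_apply, Sum.inr.injEq,
      Sum.inl.injEq, EmbeddingLike.apply_eq_iff_eq, Prod.mk.injEq, smul_eq_mul, mul_ite, mul_one,
      mul_zero]
    by_cases hf : f' = f
    · by_cases ha : a' = a
      · by_cases hx : x' = x
        · subst hf ha hx
          simp [Finset.sum_ite_eq']
        · simp [hx]
      · simp [ha]
    · simp [hf]

variable {S : ℕ} [NeZero S]

/-- **The placing map intertwines the `γ₅` substitutions of the box and of the torus**:
`P_v ∘ K₀ = K₀^{torus} ∘ P_v` on coefficient vectors (the substitution does not move sites). -/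
theorem placeLin_comp_fermiKLin (v : Site 4) :
    placeLin Nf R S v ∘ₗ fermiKLin = torusKLin ∘ₗ placeLin Nf R S v := by
  classical
  refine (Pi.basisFun ℂ _).ext fun w => ?_
  obtain ⟨y, rfl⟩ : ∃ y, toLex y = w := ⟨ofLex w, rfl⟩
  rcases y with i | i
  · obtain ⟨⟨f, x, a, α⟩, rfl⟩ := boxQuarkEquiv.surjective i
    rw [Pi.basisFun_apply, LinearMap.comp_apply, LinearMap.comp_apply, fermiKLin_single_inl,
      map_sum, placeLin_single]
    simp only [map_smul, placeLin_single, QCDLatticeObservable.toTorusIdx, ofLex_toLex,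
      Equiv.symm_apply_apply, torusKLin_single_inl]
  · obtain ⟨⟨f, x, a, α⟩, rfl⟩ := boxQuarkEquiv.surjective i
    rw [Pi.basisFun_apply, LinearMap.comp_apply, LinearMap.comp_apply, fermiKLin_single_inr,
      map_sum, placeLin_single]
    simp only [map_smul, placeLin_single, QCDLatticeObservable.toTorusIdx, ofLex_toLex,
      Equiv.symm_apply_apply, torusKLin_single_inr]

/-- **Placing commutes with the `γ₅`-conjugation at the level of the Grassmann algebras**:
`Λ(P_v) (K a) = torusK (Λ(P_v) a)`. -/
theorem map_placeLin_fermiK (v : Site 4) (a : BoxFermiAlg Nf R) :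
    ExteriorAlgebra.map (placeLin Nf R S v) (fermiK a) =
      torusK (ExteriorAlgebra.map (placeLin Nf R S v) a) := by
  induction a using ExteriorAlgebra.induction with
  | algebraMap c => simp only [fermiK_algebraMap, AlgHom.commutes, torusK_algebraMap]
  | ι u =>
    rw [fermiK_ι, ExteriorAlgebra.map_apply_ι, ExteriorAlgebra.map_apply_ι, torusK_ι,
      ← placeLin_star]
    exact congrArg (ExteriorAlgebra.ι ℂ) (LinearMap.congr_fun (placeLin_comp_fermiKLin v) (star u))
  | mul a b ha hb => simp only [fermiK_mul, map_mul, ha, hb, torusK_mul]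
  | add a b ha hb => simp only [map_add, ha, hb]

/-- **`(A^K).onTorus = torusK ∘ A.onTorus`**: placing the `γ₅`-conjugate of a local observable at `v` on the
torus of side `S` is the torus `γ₅`-conjugation of the placed observable, on the SAME gauge field. -/
theorem kConj_onTorus (A : QCDLatticeObservable Nf R) (v : Site 4)
    (U : GaugeConfig 4 S (Matrix.specialUnitaryGroup (Fin 3) ℂ)) :
    A.kConj.onTorus S v U = torusK (A.onTorus S v U) := by
  unfold QCDLatticeObservable.onTorus
  rw [QCDLatticeObservable.kConj_F]
  exact map_placeLin_fermiK v _

/-- **Conjunct 4 (placement through any `γ₅`-conjugation)**: for every map `K` of the torus quark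
Grassmann algebra with the six clauses, `(A^K).onTorus S v U = K (A.onTorus S v U)` (`kConj_onTorus` and
uniqueness of `γ₅`-conjugations, `eq_torusK_of_clauses`). -/
theorem kConj_onTorus_of_clauses (A : QCDLatticeObservable Nf R) (K : FermiAlg Nf S → FermiAlg Nf S)
    (hK : (∀ x y, K (x * y) = K x * K y) ∧ (∀ x y, K (x + y) = K x + K y) ∧
      (∀ (c : ℂ) (x : FermiAlg Nf S), K (c • x) = starRingEnd ℂ c • K x) ∧ K 1 = 1 ∧
      (∀ v : QuarkVar Nf S, K (q v) =
        -∑ σ : Fin 4, gammaFive σ v.2.2.2 • qbar (v.1, (v.2.1, v.2.2.1, σ))) ∧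
      (∀ v : QuarkVar Nf S, K (qbar v) =
        ∑ σ : Fin 4, gammaFive v.2.2.2 σ • q (v.1, (v.2.1, v.2.2.1, σ))))
    (v : Site 4) (U : GaugeConfig 4 S (Matrix.specialUnitaryGroup (Fin 3) ℂ)) :
    A.kConj.onTorus S v U = K (A.onTorus S v U) := by
  obtain ⟨hmul, hadd, hsmul, hone, hq, hqbar⟩ := hK
  rw [kConj_onTorus, eq_torusK_of_clauses hmul hadd hsmul hone hq hqbar]

/-! ### The registered stub -/

/-- **Stub K2 of the birth skeleton of `TorusHalfSpectrum` (= `ConjugationObservableStmt` unfolded): the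
observable-level conjugation `A ↦ A^K`.**  Witness: the Literature `QCDLatticeObservable.kConj`
(`(A^K)(U) = K(A(U))`).  Charge flip: `kConj_charge`; `ΘK = KΘ` at the level of `.F` and of `.onTorus`:
`kConj_osAdjoint_F`, `kConj_osAdjoint_onTorus`; placement through any `γ₅`-conjugation:
`kConj_onTorus_of_clauses`. -/
theorem stub_gammaFiveConj_observable :
    ∃ Kobs : ∀ (Nf R : ℕ), QCDLatticeObservable Nf R → QCDLatticeObservable Nf R,
      (∀ (Nf R : ℕ) (A : QCDLatticeObservable Nf R) (qA : Fin Nf → ℤ),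
          (∀ t : Fin Nf → ℂ, (∀ f, t f ≠ 0) → ∀ U,
              QCDLatticeObservable.flavourScale t (A.F U) = (∏ f, t f ^ (qA f)) • A.F U) →
          ∀ t : Fin Nf → ℂ, (∀ f, t f ≠ 0) → ∀ U,
              QCDLatticeObservable.flavourScale t ((Kobs Nf R A).F U) =
                (∏ f, t f ^ ((-qA) f)) • (Kobs Nf R A).F U) ∧
      (∀ (Nf R : ℕ) (A : QCDLatticeObservable Nf R) (U : _root_.Literature.MathematicalPhysics.QuantumLattice.LGConfig 4 (Matrix.specialUnitaryGroup (Fin 3) ℂ)),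
          (Kobs Nf R A).osAdjoint.F U = (Kobs Nf R A.osAdjoint).F U) ∧
      (∀ (Nf R : ℕ) (A : QCDLatticeObservable Nf R) (S : ℕ) [NeZero S]
          (v : _root_.Literature.Probability.LatticeModels.Site 4)
          (U : GaugeConfig 4 S (Matrix.specialUnitaryGroup (Fin 3) ℂ)),
          (Kobs Nf R A).osAdjoint.onTorus S v U = (Kobs Nf R A.osAdjoint).onTorus S v U) ∧
      (∀ (Nf R : ℕ) (A : QCDLatticeObservable Nf R) (S : ℕ) [NeZero S] (K : FermiAlg Nf S → FermiAlg Nf S),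
          ((∀ x y, K (x * y) = K x * K y) ∧ (∀ x y, K (x + y) = K x + K y) ∧
            (∀ (c : ℂ) (x : FermiAlg Nf S), K (c • x) = starRingEnd ℂ c • K x) ∧ K 1 = 1 ∧
            (∀ v : QuarkVar Nf S, K (_root_.Literature.MathematicalPhysics.QuantumFieldTheory.q v) =
              -∑ σ : Fin 4, _root_.Literature.MathematicalPhysics.QuantumLattice.gammaFive σ v.2.2.2 •
                _root_.Literature.MathematicalPhysics.QuantumFieldTheory.qbar (v.1, (v.2.1, v.2.2.1, σ))) ∧
            (∀ v : QuarkVar Nf S, K (_root_.Literature.MathematicalPhysics.QuantumFieldTheory.qbar v) =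
              ∑ σ : Fin 4, _root_.Literature.MathematicalPhysics.QuantumLattice.gammaFive v.2.2.2 σ •
                _root_.Literature.MathematicalPhysics.QuantumFieldTheory.q (v.1, (v.2.1, v.2.2.1, σ)))) →
          ∀ (v : _root_.Literature.Probability.LatticeModels.Site 4)
            (U : GaugeConfig 4 S (Matrix.specialUnitaryGroup (Fin 3) ℂ)),
            (Kobs Nf R A).onTorus S v U = K (A.onTorus S v U)) := by
  refine ⟨fun Nf R A => A.kConj, kConj_charge, fun Nf R A U => kConj_osAdjoint_F A U,
    fun Nf R A S _ v U => kConj_osAdjoint_onTorus A S v U,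
    fun Nf R A S _ K hK v U => kConj_onTorus_of_clauses A K hK v U⟩

end Summit.QuantumFields.QCD.Cruxes.TorusHalfSpectrum.Birth.GammaFiveConjObservable

end
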